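import Summits.QuantumFields.BalabanUV.T4Continuum.Support.ScalarCovariantLaplacian

/-!
# T⁴ programme, spine node NE2 (U1a) — THE COLOUR SCALAR LAYER, file 1b: the (H-bd) HALF of `PerturbationLaws` for
# `P_s = S_U − Δ′ ⊗ 1` — `‖P_s·(G′ ⊗ 1)‖, ‖(G′ ⊗ 1)·P_s‖ ≤ κ_s(α, β, τ)` (tier B, supplier row B4.e of `t4/formal/NE2/LEAVES.md`)

NE2 formalisation swarm `b2b-balaban-t4-ne2-formalise-*`, leaf 01 (row B4.e, file 1b; companion of `Support/ScalarCovariantLaplacian`, p208899).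
With `P_s = (F + Fᴴ + siteMul z) + a′·((B·siteMul T)ᴴ(B·siteMul T) − BᴴB)` (`scalarPert_eq`) and the `U = 1` bounds of row B4.c
(`ScalarAveragedPropagator`, p208102: `‖G′‖ ≤ g := γ′⁻¹`, `‖∂_μG′‖, ‖G′∂_μᴴ‖ ≤ √g` — positivity, no (1.89)), the RELATIVE BOUNDEDNESS of the
scalar-layer perturbation follows from THREE numbers on the data: the size `‖w_μ(x)‖ ≤ α` of the connection `w = n(R − 1)`, its lattice-Lipschitz
constant `‖w_μ(x + e_ν) − w_μ(x)‖ ≤ β/n`, and the size `‖T(x) − 1‖ ≤ τ` of the site transports: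
 * §1 `‖F·(G′ ⊗ 1)‖ ≤ dα√g` (**`opNorm_Fshape_mul_le`**); the ADJOINT shape **`opNorm_FshapeH_mul_le`**: `‖Fᴴ·(G′ ⊗ 1)‖ ≤ d(α√g + βg)` by
   `(∂_μ ⊗ 1)ᴴ = −(S_μ ⊗ 1)ᴴ(∂_μ ⊗ 1)` (**`kronSdiff_conjTranspose`**) and the colour Leibniz rule (`GaugeTermDecomposition.kronShiftS_mul_siteMul`),
   which moves `∂_μ` through `siteMul(w_μᴴ)` at the price `β`; the zeroth order **`norm_zfieldS_le`** `‖z(x)‖ ≤ d(α² + 2β)`; the Gram part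
   **`opNorm_gramS_mul_le`** `≤ τ(2 + τ)g` (`E = B·siteMul(T − 1)`, `‖B‖ ≤ 1`);
 * §2 **`opNorm_scalarPert_mul_Gps_le`** / **`opNorm_Gps_mul_scalarPert_le`** (the latter by Hermitian symmetry):
   `≤ kappaS d a′ α β τ = d(2α√g + βg) + d(α² + 2β)g + a′τ(2 + τ)g`, and the tower-ready forms **`opNorm_scalarPert_mul_inv_le`** /
   **`opNorm_inv_mul_scalarPert_le`** against `(DeltaPs ⊗ 1)⁻¹` — the two (H-bd) fields of `BackgroundResolventTower.PerturbationLaws` for the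
   scalar layer at every level, UNIFORM in `n` (file 2 adds (H-cons) over the scalar King planting of row B4.d).

HONEST FRAMING (T4-DAG p. 1).  MODEL LEVEL (transporters / site transports as DATA, global small field), scalar layer only, finite torus, linear
layer, operator norm; a SUPPLIER of row B4.b, NOT NE2; NOT [Balaban1985BackgroundPropagators] (3.23)–(3.26) as printed; constants OURS; nothing printed
is a hypothesis; no `def … : Prop` fact; spine 0/9 unchanged; NOT infinite volume / mass gap / Clay / summit progress.  HONEST DEPENDENCY: continuum YM
on T⁴ ⇐ BetaPertH ∧ nine spine estimates (0/9 proved); BetaPertH ⇐ (D1) ∧ (D4) ∧ CAP+tail; G-an2-4 gates asym, D1 and NE2/3/4.  ABSOLUTE RULE kept;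
no `sorry`.
-/

noncomputable section

open scoped BigOperators ComplexConjugate Matrix Matrix.Norms.L2Operator Kronecker

namespace Summit.QuantumFields.BalabanUV.T4Continuum.ScalarCovariantLaplacian

open Literature.MathematicalPhysics.QuantumFieldTheory.Balaban1983to89.B5Prop11Plancherel (Tor fine unitVec)
open Literature.MathematicalPhysics.QuantumFieldTheory.Balaban1983to89.B5Action121 (shiftS sdiff LapS)
open Literature.MathematicalPhysics.QuantumFieldTheory.Balaban1983to89.B5Block118 (QsOp)
open Summit.QuantumFields.BalabanUV.T4Continuum
open Summit.QuantumFields.BalabanUV.T4Continuum.KroneckerLift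
open Summit.QuantumFields.BalabanUV.T4Continuum.BlockMultiplication
open Summit.QuantumFields.BalabanUV.T4Continuum.AbelianCovariantLaplacian (star_natCast_complex)
open Summit.QuantumFields.BalabanUV.T4Continuum.GaugeTermDecomposition
open Summit.QuantumFields.BalabanUV.T4Continuum.ScalarAveragedPropagator

variable {d : ℕ} {o : Type*} [Fintype o] [DecidableEq o]

section Bounds

variable (n : ℕ) [NeZero n] (M : Fin d → ℕ) [hM : ∀ μ, NeZero (M μ)]

/-- **`(∂_μ ⊗ 1)ᴴ = −(S_μ ⊗ 1)ᴴ·(∂_μ ⊗ 1)`** (real lattice factor; `S_μᴴS_μ = 1`). [folklore] -/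
theorem kronSdiff_conjTranspose (μ : Fin d) :
    (sdiff (fine n M) ((n : ℕ) : ℂ) μ ⊗ₖ (1 : Matrix o o ℂ))ᴴ
      = -((shiftS (fine n M) μ ⊗ₖ (1 : Matrix o o ℂ))ᴴ * sdiff (fine n M) ((n : ℕ) : ℂ) μ ⊗ₖ (1 : Matrix o o ℂ)) := by
  have h : (sdiff (fine n M) ((n : ℕ) : ℂ) μ)ᴴ = -((shiftS (fine n M) μ)ᴴ * sdiff (fine n M) ((n : ℕ) : ℂ) μ) := by
    rw [sdiff_def, Matrix.conjTranspose_smul, star_natCast_complex, Matrix.conjTranspose_sub, Matrix.conjTranspose_one, Matrix.mul_smul,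
      Matrix.mul_sub, Matrix.mul_one, conjTranspose_shiftS_mul_shiftS, ← smul_neg, neg_sub]
  have hneg : ∀ A : Matrix (Tor (fine n M)) (Tor (fine n M)) ℂ, (-A) ⊗ₖ (1 : Matrix o o ℂ) = -(A ⊗ₖ (1 : Matrix o o ℂ)) := fun A => by
    rw [eq_neg_iff_add_eq_zero, ← Matrix.add_kronecker, neg_add_cancel, Matrix.zero_kronecker]
  rw [kron_conjTranspose, kron_conjTranspose, ← kron_mul, h, hneg]

/-- the colour Leibniz rule on 0-forms: `(∂_μ ⊗ 1)·siteMul v = siteMul (v(· + e_μ))·(∂_μ ⊗ 1) + n·(siteMul (v(· + e_μ)) − siteMul v)`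
(0-form twin of `BlockMultiplication.kronFdiff_mul_siteMul`). [folklore] -/
theorem kronSdiff_mul_siteMul (μ : Fin d) (v : Tor (fine n M) → Matrix o o ℂ) :
    sdiff (fine n M) ((n : ℕ) : ℂ) μ ⊗ₖ (1 : Matrix o o ℂ) * siteMul v
      = siteMul (fun x => v (x + unitVec (fine n M) μ)) * sdiff (fine n M) ((n : ℕ) : ℂ) μ ⊗ₖ (1 : Matrix o o ℂ)
        + ((n : ℕ) : ℂ) • (siteMul (fun x => v (x + unitVec (fine n M) μ)) - siteMul v) := by
  rw [sdiff_def, Matrix.smul_kronecker, sub_kronecker, Matrix.one_kronecker_one, Matrix.smul_mul, Matrix.mul_smul, Matrix.sub_mul,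
    Matrix.mul_sub, Matrix.one_mul, Matrix.mul_one, kronShiftS_mul_siteMul, ← smul_add]
  congr 1; abel

/-- the relative-boundedness constant of the scalar layer `κ_s = d(2α√g + βg) + d(α² + 2β)g + a′τ(2 + τ)g`, `g = γ′⁻¹` — OURS. [folklore] -/
def kappaS (d : ℕ) (a' α β τ : ℝ) : ℝ :=
  d * (2 * α * Real.sqrt ((gammaPs d a')⁻¹) + β * (gammaPs d a')⁻¹) + d * (α ^ 2 + 2 * β) * (gammaPs d a')⁻¹
    + a' * (τ * (2 + τ)) * (gammaPs d a')⁻¹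

variable {a' : ℝ}

/-- `‖F·(G′ ⊗ 1)‖ ≤ d·α·√g`. [folklore] -/
theorem opNorm_Fshape_mul_le (ha' : 0 < a') {R : Fin d → (Tor (fine n M) → Matrix o o ℂ)} {α : ℝ} (hα : 0 ≤ α)
    (hR : ∀ μ x, ‖connS (fine n M) ((n : ℕ) : ℂ) R μ x‖ ≤ α) :
    ‖Fshape (fine n M) ((n : ℕ) : ℂ) R * (Gps n M a' ⊗ₖ (1 : Matrix o o ℂ))‖ ≤ d * (α * Real.sqrt ((gammaPs d a')⁻¹)) := by
  rw [Fshape, Matrix.sum_mul]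
  refine (norm_sum_le _ _).trans ?_
  have hterm : ∀ μ ∈ Finset.univ, ‖siteMul (fun x => -(connS (fine n M) ((n : ℕ) : ℂ) R μ x)) * sdiff (fine n M) ((n : ℕ) : ℂ) μ
      ⊗ₖ (1 : Matrix o o ℂ) * (Gps n M a' ⊗ₖ (1 : Matrix o o ℂ))‖ ≤ α * Real.sqrt ((gammaPs d a')⁻¹) := by
    intro μ _
    rw [Matrix.mul_assoc, ← kron_mul]
    refine (Matrix.l2_opNorm_mul _ _).trans (mul_le_mul (opNorm_siteMul_le _ hα fun x => ?_)
      (opNorm_kron_le_of_le o (opNorm_sdiff_mul_Gps_le n M ha' μ)) (norm_nonneg _) hα)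
    rw [norm_neg]; exact hR μ x
  refine (Finset.sum_le_sum hterm).trans (le_of_eq ?_)
  rw [Finset.sum_const, Finset.card_univ, Fintype.card_fin, nsmul_eq_mul]

/-- **THE ADJOINT SHAPE** `‖Fᴴ·(G′ ⊗ 1)‖ ≤ d·(α√g + βg)`. [folklore] -/
theorem opNorm_FshapeH_mul_le (ha' : 0 < a') {R : Fin d → (Tor (fine n M) → Matrix o o ℂ)} {α β : ℝ} (hα : 0 ≤ α) (hβ : 0 ≤ β)
    (hR : ∀ μ x, ‖connS (fine n M) ((n : ℕ) : ℂ) R μ x‖ ≤ α)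
    (hLip : ∀ μ ν x, ‖connS (fine n M) ((n : ℕ) : ℂ) R μ (x + unitVec (fine n M) ν) - connS (fine n M) ((n : ℕ) : ℂ) R μ x‖ ≤ β / n) :
    ‖(Fshape (fine n M) ((n : ℕ) : ℂ) R)ᴴ * (Gps n M a' ⊗ₖ (1 : Matrix o o ℂ))‖
      ≤ d * (α * Real.sqrt ((gammaPs d a')⁻¹) + β * (gammaPs d a')⁻¹) := by
  have hn0 : (0 : ℝ) < n := by exact_mod_cast Nat.pos_of_ne_zero (NeZero.ne n)
  have hγ := (gammaPs_pos (d := d) (a' := a')).1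
  have hg : 0 ≤ (gammaPs d a')⁻¹ := inv_nonneg.mpr hγ.le
  rw [Fshape, Matrix.conjTranspose_sum, Matrix.sum_mul]
  refine (norm_sum_le _ _).trans ?_
  have hterm : ∀ μ ∈ Finset.univ, ‖(siteMul (fun x => -(connS (fine n M) ((n : ℕ) : ℂ) R μ x)) * sdiff (fine n M) ((n : ℕ) : ℂ) μ
      ⊗ₖ (1 : Matrix o o ℂ))ᴴ * (Gps n M a' ⊗ₖ (1 : Matrix o o ℂ))‖ ≤ α * Real.sqrt ((gammaPs d a')⁻¹) + β * (gammaPs d a')⁻¹ := by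
    intro μ _
    set w := connS (fine n M) ((n : ℕ) : ℂ) R μ with hw
    set v : Tor (fine n M) → Matrix o o ℂ := fun x => (-(w x))ᴴ with hv
    set v' : Tor (fine n M) → Matrix o o ℂ := fun x => v (x + unitVec (fine n M) μ) with hv'
    have hvb : ∀ x, ‖v' x‖ ≤ α := fun x => by
      simp only [hv', hv, Matrix.conjTranspose_neg, norm_neg, Matrix.l2_opNorm_conjTranspose]; exact hR μ _
    have hvd : ∀ x, ‖v' x - v x‖ ≤ β / n := fun x => by
      have e : v' x - v x = -((w (x + unitVec (fine n M) μ) - w x)ᴴ) := by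
        simp only [hv', hv, Matrix.conjTranspose_neg, Matrix.conjTranspose_sub]; abel
      rw [e, norm_neg, Matrix.l2_opNorm_conjTranspose]; exact hLip μ μ x
    have e1 : (siteMul (fun x => -(w x)) * sdiff (fine n M) ((n : ℕ) : ℂ) μ ⊗ₖ (1 : Matrix o o ℂ))ᴴ * (Gps n M a' ⊗ₖ (1 : Matrix o o ℂ))
        = -((shiftS (fine n M) μ ⊗ₖ (1 : Matrix o o ℂ))ᴴ
            * (sdiff (fine n M) ((n : ℕ) : ℂ) μ ⊗ₖ (1 : Matrix o o ℂ) * siteMul v * (Gps n M a' ⊗ₖ (1 : Matrix o o ℂ)))) := by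
      rw [Matrix.conjTranspose_mul, siteMul_conjTranspose, kronSdiff_conjTranspose]
      simp only [Matrix.neg_mul, Matrix.mul_assoc, hv]
    have e2 : sdiff (fine n M) ((n : ℕ) : ℂ) μ ⊗ₖ (1 : Matrix o o ℂ) * siteMul v * (Gps n M a' ⊗ₖ (1 : Matrix o o ℂ))
        = siteMul v' * (sdiff (fine n M) ((n : ℕ) : ℂ) μ * Gps n M a') ⊗ₖ (1 : Matrix o o ℂ)
          + ((n : ℕ) : ℂ) • ((siteMul v' - siteMul v) * (Gps n M a' ⊗ₖ (1 : Matrix o o ℂ))) := by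
      rw [kronSdiff_mul_siteMul, Matrix.add_mul, Matrix.smul_mul, Matrix.mul_assoc, ← kron_mul]
    rw [e1, norm_neg]
    calc _ ≤ ‖(shiftS (fine n M) μ ⊗ₖ (1 : Matrix o o ℂ))ᴴ‖
            * ‖sdiff (fine n M) ((n : ℕ) : ℂ) μ ⊗ₖ (1 : Matrix o o ℂ) * siteMul v * (Gps n M a' ⊗ₖ (1 : Matrix o o ℂ))‖ :=
          Matrix.l2_opNorm_mul _ _
      _ ≤ 1 * (α * Real.sqrt ((gammaPs d a')⁻¹) + β * (gammaPs d a')⁻¹) := by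
          refine mul_le_mul ?_ ?_ (norm_nonneg _) zero_le_one
          · rw [Matrix.l2_opNorm_conjTranspose]; exact opNorm_kron_le_of_le o (opNorm_shiftS_le _ μ)
          · rw [e2]
            refine (norm_add_le _ _).trans (add_le_add ?_ ?_)
            · exact (Matrix.l2_opNorm_mul _ _).trans (mul_le_mul (opNorm_siteMul_le _ hα hvb)
                (opNorm_kron_le_of_le o (opNorm_sdiff_mul_Gps_le n M ha' μ)) (norm_nonneg _) hα)
            · rw [norm_smul, Complex.norm_natCast, ← siteMul_sub]
              calc (n : ℝ) * ‖siteMul (fun i => v' i - v i) * (Gps n M a' ⊗ₖ (1 : Matrix o o ℂ))‖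
                  ≤ (n : ℝ) * (β / n * (gammaPs d a')⁻¹) := by
                    refine mul_le_mul_of_nonneg_left ((Matrix.l2_opNorm_mul _ _).trans (mul_le_mul (opNorm_siteMul_le _ (by positivity) hvd)
                      (opNorm_kron_le_of_le o (opNorm_Gps_le n M ha')) (norm_nonneg _) (by positivity))) hn0.le
                _ = β * (gammaPs d a')⁻¹ := by field_simp
      _ = _ := one_mul _
  refine (Finset.sum_le_sum hterm).trans (le_of_eq ?_)
  rw [Finset.sum_const, Finset.card_univ, Fintype.card_fin, nsmul_eq_mul]

omit hM in
/-- **THE ZEROTH-ORDER FIELD IS BOUNDED**: `‖z(x)‖ ≤ d·(α² + 2β)`. [folklore] -/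
theorem norm_zfieldS_le {R : Fin d → (Tor (fine n M) → Matrix o o ℂ)} {α β : ℝ} (hα : 0 ≤ α)
    (hR : ∀ μ x, ‖connS (fine n M) ((n : ℕ) : ℂ) R μ x‖ ≤ α)
    (hLip : ∀ μ ν x, ‖connS (fine n M) ((n : ℕ) : ℂ) R μ (x + unitVec (fine n M) ν) - connS (fine n M) ((n : ℕ) : ℂ) R μ x‖ ≤ β / n)
    (x : Tor (fine n M)) : ‖zfieldS (fine n M) ((n : ℕ) : ℂ) R x‖ ≤ d * (α ^ 2 + 2 * β) := by
  have hn0 : (0 : ℝ) < n := by exact_mod_cast Nat.pos_of_ne_zero (NeZero.ne n)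
  unfold zfieldS
  refine (norm_sum_le _ _).trans ?_
  have hterm : ∀ μ ∈ Finset.univ, ‖(connS (fine n M) ((n : ℕ) : ℂ) R μ (x - unitVec (fine n M) μ))ᴴ * connS (fine n M) ((n : ℕ) : ℂ) R μ
        (x - unitVec (fine n M) μ)
      - ((n : ℕ) : ℂ) • (connS (fine n M) ((n : ℕ) : ℂ) R μ x - connS (fine n M) ((n : ℕ) : ℂ) R μ (x - unitVec (fine n M) μ))
      - ((n : ℕ) : ℂ) • (connS (fine n M) ((n : ℕ) : ℂ) R μ x - connS (fine n M) ((n : ℕ) : ℂ) R μ (x - unitVec (fine n M) μ))ᴴ‖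
        ≤ α ^ 2 + 2 * β := by
    intro μ _
    set w := connS (fine n M) ((n : ℕ) : ℂ) R μ with hw
    have hd : ‖((n : ℕ) : ℂ) • (w x - w (x - unitVec (fine n M) μ))‖ ≤ β := by
      have h := hLip μ μ (x - unitVec (fine n M) μ)
      rw [sub_add_cancel] at h
      rw [norm_smul, Complex.norm_natCast]
      calc (n : ℝ) * ‖w x - w (x - unitVec (fine n M) μ)‖ ≤ (n : ℝ) * (β / n) := mul_le_mul_of_nonneg_left h hn0.le
        _ = β := by field_simp
    have hsq : ‖(w (x - unitVec (fine n M) μ))ᴴ * w (x - unitVec (fine n M) μ)‖ ≤ α ^ 2 := by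
      calc _ ≤ ‖(w (x - unitVec (fine n M) μ))ᴴ‖ * ‖w (x - unitVec (fine n M) μ)‖ := Matrix.l2_opNorm_mul _ _
        _ ≤ α * α := by
            rw [Matrix.l2_opNorm_conjTranspose]; exact mul_le_mul (hR μ _) (hR μ _) (norm_nonneg _) hα
        _ = α ^ 2 := (sq α).symm
    have hd' : ‖((n : ℕ) : ℂ) • (w x - w (x - unitVec (fine n M) μ))ᴴ‖ ≤ β := by
      rw [norm_smul, Matrix.l2_opNorm_conjTranspose, ← norm_smul]; exact hd
    calc _ ≤ ‖(w (x - unitVec (fine n M) μ))ᴴ * w (x - unitVec (fine n M) μ) - ((n : ℕ) : ℂ) • (w x - w (x - unitVec (fine n M) μ))‖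
            + ‖((n : ℕ) : ℂ) • (w x - w (x - unitVec (fine n M) μ))ᴴ‖ := norm_sub_le _ _
      _ ≤ (α ^ 2 + β) + β := add_le_add ((norm_sub_le _ _).trans (add_le_add hsq hd)) hd'
      _ = α ^ 2 + 2 * β := by ring
  refine (Finset.sum_le_sum hterm).trans (le_of_eq ?_)
  rw [Finset.sum_const, Finset.card_univ, Fintype.card_fin, nsmul_eq_mul]

/-- `‖siteMul z·(G′ ⊗ 1)‖ ≤ d(α² + 2β)·g`. [folklore] -/
theorem opNorm_zfield_mul_le (ha' : 0 < a') {R : Fin d → (Tor (fine n M) → Matrix o o ℂ)} {α β : ℝ} (hα : 0 ≤ α) (hβ : 0 ≤ β)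
    (hR : ∀ μ x, ‖connS (fine n M) ((n : ℕ) : ℂ) R μ x‖ ≤ α)
    (hLip : ∀ μ ν x, ‖connS (fine n M) ((n : ℕ) : ℂ) R μ (x + unitVec (fine n M) ν) - connS (fine n M) ((n : ℕ) : ℂ) R μ x‖ ≤ β / n) :
    ‖siteMul (zfieldS (fine n M) ((n : ℕ) : ℂ) R) * (Gps n M a' ⊗ₖ (1 : Matrix o o ℂ))‖ ≤ d * (α ^ 2 + 2 * β) * (gammaPs d a')⁻¹ := by
  have hK : 0 ≤ (d : ℝ) * (α ^ 2 + 2 * β) := by positivity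
  exact (Matrix.l2_opNorm_mul _ _).trans (mul_le_mul (opNorm_siteMul_le _ hK (norm_zfieldS_le n M hα hR hLip))
    (opNorm_kron_le_of_le o (opNorm_Gps_le n M ha')) (norm_nonneg _) hK)

/-- **THE GRAM PART** `‖((B·siteMul T)ᴴ(B·siteMul T) − BᴴB)·(G′ ⊗ 1)‖ ≤ τ(2 + τ)·g` (`E = B·siteMul(T − 1)`, `‖E‖ ≤ τ`, `‖B‖ ≤ 1`). [folklore] -/
theorem opNorm_gramS_mul_le (ha' : 0 < a') {T : Tor (fine n M) → Matrix o o ℂ} {τ : ℝ} (hτ : 0 ≤ τ) (hT : ∀ x, ‖T x - 1‖ ≤ τ) :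
    ‖((Bs o n M * siteMul T)ᴴ * (Bs o n M * siteMul T) - (Bs o n M)ᴴ * Bs o n M) * (Gps n M a' ⊗ₖ (1 : Matrix o o ℂ))‖
      ≤ τ * (2 + τ) * (gammaPs d a')⁻¹ := by
  have hγ := (gammaPs_pos (d := d) (a' := a')).1
  set B := Bs o n M with hB
  set E := B * siteMul (fun x => T x - 1) with hE
  have hBE : B * siteMul T = B + E := by
    rw [hE, siteMul_sub, siteMul_one, Matrix.mul_sub, Matrix.mul_one, add_sub_cancel]
  have hEn : ‖E‖ ≤ τ := (Matrix.l2_opNorm_mul _ _).trans ((mul_le_mul (opNorm_Bs_le o n M) (opNorm_siteMul_le _ hτ hT) (norm_nonneg _)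
    zero_le_one).trans (le_of_eq (one_mul τ)))
  have hBn : ‖B‖ ≤ 1 := opNorm_Bs_le o n M
  have e : (B * siteMul T)ᴴ * (B * siteMul T) - Bᴴ * B = Bᴴ * E + Eᴴ * B + Eᴴ * E := by
    rw [hBE, Matrix.conjTranspose_add, Matrix.add_mul, Matrix.mul_add, Matrix.mul_add]; abel
  rw [e]
  have hX : ‖Bᴴ * E + Eᴴ * B + Eᴴ * E‖ ≤ τ * (2 + τ) := by
    have hBH : ‖Bᴴ‖ ≤ 1 := by rw [Matrix.l2_opNorm_conjTranspose]; exact hBn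
    have hEH : ‖Eᴴ‖ ≤ τ := by rw [Matrix.l2_opNorm_conjTranspose]; exact hEn
    calc _ ≤ ‖Bᴴ * E‖ + ‖Eᴴ * B‖ + ‖Eᴴ * E‖ := (norm_add_le _ _).trans (add_le_add (norm_add_le _ _) le_rfl)
      _ ≤ 1 * τ + τ * 1 + τ * τ := add_le_add (add_le_add
          ((Matrix.l2_opNorm_mul _ _).trans (mul_le_mul hBH hEn (norm_nonneg _) zero_le_one))
          ((Matrix.l2_opNorm_mul _ _).trans (mul_le_mul hEH hBn (norm_nonneg _) hτ)))
          ((Matrix.l2_opNorm_mul _ _).trans (mul_le_mul hEH hEn (norm_nonneg _) hτ))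
      _ = τ * (2 + τ) := by ring
  exact (Matrix.l2_opNorm_mul _ _).trans (mul_le_mul hX (opNorm_kron_le_of_le o (opNorm_Gps_le n M ha')) (norm_nonneg _) (by positivity))

/-- **(H-bd), RIGHT: `‖P_s·(G′ ⊗ 1)‖ ≤ κ_s`**. [folklore] -/
theorem opNorm_scalarPert_mul_Gps_le (ha' : 0 < a') {R : Fin d → (Tor (fine n M) → Matrix o o ℂ)} {T : Tor (fine n M) → Matrix o o ℂ}
    {α β τ : ℝ} (hα : 0 ≤ α) (hβ : 0 ≤ β) (hτ : 0 ≤ τ) (hR : ∀ μ x, ‖connS (fine n M) ((n : ℕ) : ℂ) R μ x‖ ≤ α)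
    (hLip : ∀ μ ν x, ‖connS (fine n M) ((n : ℕ) : ℂ) R μ (x + unitVec (fine n M) ν) - connS (fine n M) ((n : ℕ) : ℂ) R μ x‖ ≤ β / n)
    (hT : ∀ x, ‖T x - 1‖ ≤ τ) :
    ‖scalarPert n M a' R T * (Gps n M a' ⊗ₖ (1 : Matrix o o ℂ))‖ ≤ kappaS d a' α β τ := by
  rw [scalarPert_eq, Matrix.add_mul, Matrix.add_mul, Matrix.add_mul, Matrix.smul_mul]
  have h1 := opNorm_Fshape_mul_le n M ha' hα hR
  have h2 := opNorm_FshapeH_mul_le n M ha' hα hβ hR hLip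
  have h3 := opNorm_zfield_mul_le n M ha' hα hβ hR hLip
  have h4 := opNorm_gramS_mul_le n M ha' hτ hT
  have h4' : ‖(a' : ℂ) • (((Bs o n M * siteMul T)ᴴ * (Bs o n M * siteMul T) - (Bs o n M)ᴴ * Bs o n M) * (Gps n M a' ⊗ₖ (1 : Matrix o o ℂ)))‖
      ≤ a' * (τ * (2 + τ) * (gammaPs d a')⁻¹) := by
    rw [norm_smul, Complex.norm_real, Real.norm_of_nonneg ha'.le]; exact mul_le_mul_of_nonneg_left h4 ha'.le
  calc _ ≤ ‖Fshape (fine n M) ((n : ℕ) : ℂ) R * (Gps n M a' ⊗ₖ (1 : Matrix o o ℂ))‖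
          + ‖(Fshape (fine n M) ((n : ℕ) : ℂ) R)ᴴ * (Gps n M a' ⊗ₖ (1 : Matrix o o ℂ))‖
          + ‖siteMul (zfieldS (fine n M) ((n : ℕ) : ℂ) R) * (Gps n M a' ⊗ₖ (1 : Matrix o o ℂ))‖
          + ‖(a' : ℂ) • (((Bs o n M * siteMul T)ᴴ * (Bs o n M * siteMul T) - (Bs o n M)ᴴ * Bs o n M) * (Gps n M a' ⊗ₖ (1 : Matrix o o ℂ)))‖ :=
        (norm_add_le _ _).trans (add_le_add ((norm_add_le _ _).trans (add_le_add (norm_add_le _ _) le_rfl)) le_rfl)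
    _ ≤ d * (α * Real.sqrt ((gammaPs d a')⁻¹)) + d * (α * Real.sqrt ((gammaPs d a')⁻¹) + β * (gammaPs d a')⁻¹)
          + d * (α ^ 2 + 2 * β) * (gammaPs d a')⁻¹ + a' * (τ * (2 + τ) * (gammaPs d a')⁻¹) :=
        add_le_add (add_le_add (add_le_add h1 h2) h3) h4'
    _ = kappaS d a' α β τ := by unfold kappaS; ring

/-- **(H-bd), LEFT: `‖(G′ ⊗ 1)·P_s‖ ≤ κ_s`** (both factors Hermitian: `(G′ ⊗ 1)P_s = (P_s(G′ ⊗ 1))ᴴ`). [folklore] -/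
theorem opNorm_Gps_mul_scalarPert_le (ha' : 0 < a') {R : Fin d → (Tor (fine n M) → Matrix o o ℂ)} {T : Tor (fine n M) → Matrix o o ℂ}
    {α β τ : ℝ} (hα : 0 ≤ α) (hβ : 0 ≤ β) (hτ : 0 ≤ τ) (hR : ∀ μ x, ‖connS (fine n M) ((n : ℕ) : ℂ) R μ x‖ ≤ α)
    (hLip : ∀ μ ν x, ‖connS (fine n M) ((n : ℕ) : ℂ) R μ (x + unitVec (fine n M) ν) - connS (fine n M) ((n : ℕ) : ℂ) R μ x‖ ≤ β / n)
    (hT : ∀ x, ‖T x - 1‖ ≤ τ) :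
    ‖Gps n M a' ⊗ₖ (1 : Matrix o o ℂ) * scalarPert n M a' R T‖ ≤ kappaS d a' α β τ := by
  have e : Gps n M a' ⊗ₖ (1 : Matrix o o ℂ) * scalarPert n M a' R T = (scalarPert n M a' R T * (Gps n M a' ⊗ₖ (1 : Matrix o o ℂ)))ᴴ := by
    rw [Matrix.conjTranspose_mul, kron_conjTranspose, (Gps_isHermitian n M a').eq, scalarPert_conjTranspose]
  rw [e, Matrix.l2_opNorm_conjTranspose]
  exact opNorm_scalarPert_mul_Gps_le n M ha' hα hβ hτ hR hLip hT

/-- `(Δ′ ⊗ 1)⁻¹ = G′ ⊗ 1`. [folklore] -/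
theorem inv_DeltaPs_kron (a' : ℝ) : (DeltaPs n M a' ⊗ₖ (1 : Matrix o o ℂ))⁻¹ = Gps n M a' ⊗ₖ (1 : Matrix o o ℂ) := by
  rw [kron_inv, Gps]

/-- **(H-bd) IN THE `PerturbationLaws` CURRENCY, right**: `‖P_s·(Δ′ ⊗ 1)⁻¹‖ ≤ κ_s`. [folklore] -/
theorem opNorm_scalarPert_mul_inv_le (ha' : 0 < a') {R : Fin d → (Tor (fine n M) → Matrix o o ℂ)} {T : Tor (fine n M) → Matrix o o ℂ}
    {α β τ : ℝ} (hα : 0 ≤ α) (hβ : 0 ≤ β) (hτ : 0 ≤ τ) (hR : ∀ μ x, ‖connS (fine n M) ((n : ℕ) : ℂ) R μ x‖ ≤ α)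
    (hLip : ∀ μ ν x, ‖connS (fine n M) ((n : ℕ) : ℂ) R μ (x + unitVec (fine n M) ν) - connS (fine n M) ((n : ℕ) : ℂ) R μ x‖ ≤ β / n)
    (hT : ∀ x, ‖T x - 1‖ ≤ τ) :
    ‖scalarPert n M a' R T * (DeltaPs n M a' ⊗ₖ (1 : Matrix o o ℂ))⁻¹‖ ≤ kappaS d a' α β τ := by
  rw [inv_DeltaPs_kron]; exact opNorm_scalarPert_mul_Gps_le n M ha' hα hβ hτ hR hLip hT

/-- **(H-bd) IN THE `PerturbationLaws` CURRENCY, left**: `‖(Δ′ ⊗ 1)⁻¹·P_s‖ ≤ κ_s`. [folklore] -/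
theorem opNorm_inv_mul_scalarPert_le (ha' : 0 < a') {R : Fin d → (Tor (fine n M) → Matrix o o ℂ)} {T : Tor (fine n M) → Matrix o o ℂ}
    {α β τ : ℝ} (hα : 0 ≤ α) (hβ : 0 ≤ β) (hτ : 0 ≤ τ) (hR : ∀ μ x, ‖connS (fine n M) ((n : ℕ) : ℂ) R μ x‖ ≤ α)
    (hLip : ∀ μ ν x, ‖connS (fine n M) ((n : ℕ) : ℂ) R μ (x + unitVec (fine n M) ν) - connS (fine n M) ((n : ℕ) : ℂ) R μ x‖ ≤ β / n)
    (hT : ∀ x, ‖T x - 1‖ ≤ τ) :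
    ‖(DeltaPs n M a' ⊗ₖ (1 : Matrix o o ℂ))⁻¹ * scalarPert n M a' R T‖ ≤ kappaS d a' α β τ := by
  rw [inv_DeltaPs_kron]; exact opNorm_Gps_mul_scalarPert_le n M ha' hα hβ hτ hR hLip hT

end Bounds

end Summit.QuantumFields.BalabanUV.T4Continuum.ScalarCovariantLaplacian

end
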